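import Summits.ValiantsHypothesis.ValiantsHypothesis.Theorems.KPlusLogSqLawTropicalBSplitDefs

/-!
# Route «KPlusLogSqLaw», crux `TropicalB` (stmt-ValiantsHypothesis-19771) — TIGHT REFINEMENT of dominant chains in a generic design

HONEST FRAMING.  Helper toward the registered stubs `stub_tropThin` / `stub_tropFat` of `Cruxes/TropicalB/Lines/birth.lean` (crux
`Summit.ValiantsHypothesis.ValiantsHypothesis.Theses.KPlusLogSqLaw.TropicalB`, item stmt-ValiantsHypothesis-19771, route KPlusLogSqLaw; cell
`pub-symmetroid`, seat val-sym-trop-p1 g25, 2026-08-29; `--supports … --as helper`).  Part 1 of the SINGLE-ORBIT / TIGHT NORMAL FORM of the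
unsigned row `TropRowD` (…TropicalBSplitDefs): a STRUCTURE lemma about chains of one design; nothing here bounds `TropicalB` in its window and
nothing bears on `WeakLifting`, DoorA26 / DoorA34, `MatrixDescartes` (stmt-ValiantsHypothesis-18050) or VP ≠ VNP.

VOCABULARY (all inline, no definitions).  For a term `q = (σ, λ)` write `sl q = Σ_b d(λ b)` (total exponent) and `V q = Σ_b v(σ b, b, λ b)`, so that
`tropWeight d v θ q = θ·sl q − V q`.  A design `(d, v, ε)` is called **4-generic** here if
* (G1) two distinct present terms with the same total exponent have different `V`;
* (G2) no three present terms with pairwise distinct total exponents are collinear as points `(sl, V)`;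
* (G3) for present `q, q'` with `sl q < sl q'` the tie slope `(V q' − V q)/(sl q' − sl q)` is an INTEGER divisible by `4`.
(Part 2, `…TropicalBGenericPerturbation`, makes EVERY design 4-generic by `v ↦ L·(N·v + B^code)` without losing a given chain.)
A chain `q₀, …, q_j` dominant at integer slopes `ψ₀ < ⋯ < ψ_j` is **tight** with tie slopes `τ₀, …, τ_{j−1}` if `ψ_k < τ_k < ψ_{k+1}`, `q_k ≠ q_{k+1}`,
and at `τ_k` the terms `q_k`, `q_{k+1}` have EQUAL weight while every other present term is STRICTLY lighter (a two-term tie).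

* `TightChain.exists_step` — in a 4-generic design, if `p` is dominant at `ψ` and `p' ≠ p` at `θ' > ψ`, the first catching slope
  `τ = min_{sl r > sl p} (V r − V p)/(sl r − sl p)` is a two-term tie of `p` with its catcher `q` (by (G1)/(G2)), `ψ < τ < θ'`, and `q` is dominant
  at `τ + 1` (by (G3): later ties are `≥ τ + 4`); either `q = p'` or `τ + 1 < θ'`.
* `TightChain.exists_extension` — hence a tight chain ending with `p` dominant at `ψ` extends, for every `p' ≠ p` dominant at `θ' > ψ`, to a tight
  chain with at least one more term, ending with `p'` dominant at `θ'` (induction on `sl p' − sl p`).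
* `TightChain.exists_refinement` — so in a 4-generic design every unsigned dominant chain `p₀, …, pₙ` (strictly increasing integer slopes,
  consecutive terms distinct) is refined to a TIGHT chain with at least `n + 1` terms, same first term and slope, same last term and slope.
[folklore: consecutive vertices of a generic Newton polygon span an edge; here in the cell's integer dominance vocabulary]
-/

set_option linter.dupNamespace false
set_option autoImplicit false

namespace Summit.ValiantsHypothesis.ValiantsHypothesis.Theorems.KPlusLogSqLaw

open Summit.ValiantsHypothesis.ValiantsHypothesis.Theorems.MatrixDescartes.Negative
open scoped BigOperators
open Finset

namespace TightChain

variable {m K : ℕ}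

section Generic

variable (d : Fin K → ℕ) (v ε : Fin m → Fin m → Fin K → ℤ)

/-- **One envelope step.**  In a 4-generic design let `p` be dominant at `ψ` and `p' ≠ p` dominant at `θ' > ψ`.  Then there are a present term
`q ≠ p` and an integer `τ` with `ψ < τ < θ'`, `τ + 1 < θ' ∨ q = p'`, such that `p` and `q` tie two-term at `τ` (equal weights, every other
present term strictly lighter) and `q` is dominant at `τ + 1`; moreover `sl p < sl q ≤ sl p'`. [folklore] -/
theorem exists_step
    (hG1 : ∀ q q' : Equiv.Perm (Fin m) × (Fin m → Fin K), termSign ε q ≠ 0 → termSign ε q' ≠ 0 → q ≠ q' →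
      (∑ i, (d (q.2 i) : ℤ)) = ∑ i, (d (q'.2 i) : ℤ) → (∑ i, v (q.1 i) i (q.2 i)) ≠ ∑ i, v (q'.1 i) i (q'.2 i))
    (hG2 : ∀ q₁ q₂ q₃ : Equiv.Perm (Fin m) × (Fin m → Fin K), termSign ε q₁ ≠ 0 → termSign ε q₂ ≠ 0 → termSign ε q₃ ≠ 0 →
      (∑ i, (d (q₁.2 i) : ℤ)) < ∑ i, (d (q₂.2 i) : ℤ) → (∑ i, (d (q₂.2 i) : ℤ)) < ∑ i, (d (q₃.2 i) : ℤ) →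
      ((∑ i, (d (q₂.2 i) : ℤ)) - ∑ i, (d (q₁.2 i) : ℤ)) * ((∑ i, v (q₃.1 i) i (q₃.2 i)) - ∑ i, v (q₁.1 i) i (q₁.2 i)) ≠
        ((∑ i, (d (q₃.2 i) : ℤ)) - ∑ i, (d (q₁.2 i) : ℤ)) * ((∑ i, v (q₂.1 i) i (q₂.2 i)) - ∑ i, v (q₁.1 i) i (q₁.2 i)))
    (hG3 : ∀ q q' : Equiv.Perm (Fin m) × (Fin m → Fin K), termSign ε q ≠ 0 → termSign ε q' ≠ 0 →
      (∑ i, (d (q.2 i) : ℤ)) < ∑ i, (d (q'.2 i) : ℤ) →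
      ∃ ψ : ℤ, (∑ i, v (q'.1 i) i (q'.2 i)) - (∑ i, v (q.1 i) i (q.2 i)) = ψ * ((∑ i, (d (q'.2 i) : ℤ)) - ∑ i, (d (q.2 i) : ℤ)) ∧ 4 ∣ ψ)
    {ψ θ' : ℤ} {p p' : Equiv.Perm (Fin m) × (Fin m → Fin K)} (hp : IsDominant d v ε ψ p) (hp' : IsDominant d v ε θ' p')
    (hψ : ψ < θ') (hne : p ≠ p') :
    ∃ (q : Equiv.Perm (Fin m) × (Fin m → Fin K)) (τ : ℤ), termSign ε q ≠ 0 ∧ q ≠ p ∧ ψ < τ ∧ τ < θ' ∧ (τ + 1 < θ' ∨ q = p') ∧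
      tropWeight d v τ p = tropWeight d v τ q ∧
      (∀ r, termSign ε r ≠ 0 → r ≠ p → r ≠ q → tropWeight d v τ r < tropWeight d v τ p) ∧
      IsDominant d v ε (τ + 1) q ∧
      (∑ i, (d (p.2 i) : ℤ)) < (∑ i, (d (q.2 i) : ℤ)) ∧ (∑ i, (d (q.2 i) : ℤ)) ≤ ∑ i, (d (p'.2 i) : ℤ) := by
  classical
  -- abbreviations
  obtain ⟨sl, hsl⟩ : ∃ sl : (Equiv.Perm (Fin m) × (Fin m → Fin K)) → ℤ, ∀ q, sl q = ∑ i, (d (q.2 i) : ℤ) := ⟨_, fun _ => rfl⟩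
  obtain ⟨V, hV⟩ : ∃ V : (Equiv.Perm (Fin m) × (Fin m → Fin K)) → ℤ, ∀ q, V q = ∑ i, v (q.1 i) i (q.2 i) := ⟨_, fun _ => rfl⟩
  have hw : ∀ q θ, tropWeight d v θ q = θ * sl q - V q := fun q θ => by rw [hsl, hV]; rfl
  simp only [← hsl, ← hV] at hG1 hG2 hG3 ⊢
  have hp_pres : termSign ε p ≠ 0 := hp.1
  have hp'_pres : termSign ε p' ≠ 0 := hp'.1
  -- `p'` is steeper than `p`
  have h1 := hp.2 p' (Ne.symm hne) hp'_pres
  have h2 := hp'.2 p hne hp_pres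
  rw [hw, hw] at h1 h2
  have hslpp' : sl p < sl p' := by nlinarith
  -- the catchers and their tie slopes
  set C : Finset (Equiv.Perm (Fin m) × (Fin m → Fin K)) := univ.filter fun r => termSign ε r ≠ 0 ∧ sl p < sl r with hC
  have hmemC : ∀ r, r ∈ C ↔ termSign ε r ≠ 0 ∧ sl p < sl r := fun r => by rw [hC, mem_filter]; simp
  have hC_ne : C.Nonempty := ⟨p', (hmemC p').2 ⟨hp'_pres, hslpp'⟩⟩
  set f : (Equiv.Perm (Fin m) × (Fin m → Fin K)) → ℤ := fun r => (V r - V p) / (sl r - sl p) with hf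
  -- exactness of the tie slopes on `C`
  have hf_exact : ∀ r ∈ C, V r - V p = f r * (sl r - sl p) ∧ 4 ∣ f r := by
    intro r hr
    obtain ⟨hr_pres, hr_sl⟩ := (hmemC r).1 hr
    obtain ⟨φ, hφ, h4⟩ := hG3 p r hp_pres hr_pres hr_sl
    have hne0 : sl r - sl p ≠ 0 := by omega
    have hfr : f r = φ := by rw [hf]; simp only; rw [hφ, Int.mul_ediv_cancel _ hne0]
    rw [hfr]; exact ⟨hφ, h4⟩
  obtain ⟨q, hqC, hqmin⟩ := exists_min_image C f hC_ne
  obtain ⟨hq_pres, hq_sl⟩ := (hmemC q).1 hqC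
  set τ : ℤ := f q with hτ
  obtain ⟨hq_exact, hq4⟩ := hf_exact q hqC
  -- (i) `ψ < τ`: `p` beats `q` at `ψ`
  have hψτ : ψ < τ := by
    have h := hp.2 q (fun h => by rw [h] at hq_sl; exact lt_irrefl _ hq_sl) hq_pres
    rw [hw, hw] at h
    have : (τ - ψ) * (sl q - sl p) > 0 := by nlinarith [hq_exact]
    nlinarith
  -- (ii) the tie at `τ`
  have htie : tropWeight d v τ p = tropWeight d v τ q := by rw [hw, hw]; nlinarith [hq_exact]
  -- (iii) every other present term is strictly lighter at `τ`
  have honly : ∀ r, termSign ε r ≠ 0 → r ≠ p → r ≠ q → tropWeight d v τ r < tropWeight d v τ p := by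
    intro r hr hrp hrq
    rw [hw, hw]
    rcases lt_or_ge (sl p) (sl r) with hsl_lt | hsl_le
    · -- a catcher: `(τ − f r)(sl r − sl p) ≤ 0`, and equality would make `p, q, r` collinear
      have hrC : r ∈ C := (hmemC r).2 ⟨hr, hsl_lt⟩
      obtain ⟨hr_exact, _⟩ := hf_exact r hrC
      have hfr : τ ≤ f r := hqmin r hrC
      have hle : τ * sl r - V r ≤ τ * sl p - V p := by nlinarith [hr_exact]
      rcases lt_or_eq_of_le hle with hlt | heq
      · exact hlt
      · exfalso
        -- `r` ties too: `V r − V p = τ (sl r − sl p)`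
        have hr_tie : V r - V p = τ * (sl r - sl p) := by linarith
        rcases lt_trichotomy (sl q) (sl r) with hqr | hqr | hqr
        · exact hG2 p q r hp_pres hq_pres hr hq_sl hqr (by rw [hr_tie, hq_exact]; ring)
        · exact hG1 q r hq_pres hr (Ne.symm hrq) hqr (by have h' := hq_exact; rw [← hτ, hqr] at h'; linarith)
        · exact hG2 p r q hp_pres hr hq_pres hsl_lt hqr (by rw [hr_tie, hq_exact]; ring)
    · -- not steeper than `p`: strictly lighter at `ψ`, falls further behind
      have h := hp.2 r hrp hr
      rw [hw, hw] at h
      nlinarith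
  -- (iv) `q` is dominant at `τ + 1`
  have hqdom : IsDominant d v ε (τ + 1) q := by
    refine ⟨hq_pres, fun r hrq hr => ?_⟩
    by_cases hrp : r = p
    · subst hrp; rw [hw, hw]; nlinarith [hq_exact]
    have hlt := honly r hr hrp hrq
    rw [htie] at hlt
    rw [hw, hw] at hlt ⊢
    rcases le_or_gt (sl r) (sl q) with hsl_le | hsl_lt
    · nlinarith
    · -- steeper than `q`: their tie slope is a multiple of 4 beyond `τ`
      obtain ⟨φ, hφ, hφ4⟩ := hG3 q r hq_pres hr hsl_lt
      have hτφ : τ < φ := by nlinarith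
      obtain ⟨a, ha⟩ := hq4
      obtain ⟨b, hb⟩ := hφ4
      have hab : a < b := by omega
      have : τ + 4 ≤ φ := by omega
      nlinarith
  -- (v) `τ < θ'` and the dichotomy
  have hp'C : p' ∈ C := (hmemC p').2 ⟨hp'_pres, hslpp'⟩
  obtain ⟨hp'_exact, _⟩ := hf_exact p' hp'C
  have hτθ' : τ < θ' := by
    have hfp' : τ ≤ f p' := hqmin p' hp'C
    have : (θ' - f p') * (sl p' - sl p) > 0 := by nlinarith [hp'_exact]
    nlinarith
  have hdich : τ + 1 < θ' ∨ q = p' := by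
    by_cases hqp' : q = p'
    · exact Or.inr hqp'
    · left
      -- `q` dominant at `τ+1`, `p'` dominant at `θ' ≥ τ+1`, distinct ⇒ `θ' ≠ τ+1`
      rcases lt_or_eq_of_le (show τ + 1 ≤ θ' by omega) with h | h
      · exact h
      · exfalso
        have h3 := hqdom.2 p' (Ne.symm hqp') hp'_pres
        have h4 := hp'.2 q hqp' hq_pres
        rw [← h] at h4
        exact lt_asymm h3 h4
  have hq_le : sl q ≤ sl p' := by
    -- `q` dominant at `τ+1 ≤ θ'`, `p'` dominant at `θ'`: slopes weakly increase
    by_cases hqp' : q = p'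
    · rw [hqp']
    · have h3 := hqdom.2 p' (Ne.symm hqp') hp'_pres
      have h4 := hp'.2 q hqp' hq_pres
      rw [hw, hw] at h3 h4
      nlinarith
  exact ⟨q, τ, hq_pres, fun h => by rw [h] at hq_sl; exact lt_irrefl _ hq_sl, hψτ, hτθ', hdich, htie, honly, hqdom, hq_sl, hq_le⟩


/-- **Appending one tight step** (bookkeeping with `Fin.snoc`): a tight chain `(q, ψ, τ)` with `j + 1` terms, a new term `t` dominant at `s`,
and a two-term tie of `q_j` with `t ≠ q_j` at `τ*`, `ψ_j < τ* < s`, give a tight chain with `j + 2` terms, the same first term and slope,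
last term `t` and last slope `s`. [folklore] -/
theorem snoc_tight {j : ℕ} (q : Fin (j + 1) → Equiv.Perm (Fin m) × (Fin m → Fin K)) (ψ : Fin (j + 1) → ℤ) (τ : Fin j → ℤ)
    (hdom : ∀ k, IsDominant d v ε (ψ k) (q k))
    (hsep : ∀ k : Fin j, ψ k.castSucc < τ k ∧ τ k < ψ k.succ)
    (hne : ∀ k : Fin j, q k.castSucc ≠ q k.succ)
    (htie : ∀ k : Fin j, tropWeight d v (τ k) (q k.castSucc) = tropWeight d v (τ k) (q k.succ))
    (honly : ∀ k : Fin j, ∀ r, termSign ε r ≠ 0 → r ≠ q k.castSucc → r ≠ q k.succ →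
      tropWeight d v (τ k) r < tropWeight d v (τ k) (q k.castSucc))
    (t : Equiv.Perm (Fin m) × (Fin m → Fin K)) (s τs : ℤ) (ht : IsDominant d v ε s t)
    (hsep' : ψ (Fin.last j) < τs ∧ τs < s) (hne' : q (Fin.last j) ≠ t)
    (htie' : tropWeight d v τs (q (Fin.last j)) = tropWeight d v τs t)
    (honly' : ∀ r, termSign ε r ≠ 0 → r ≠ q (Fin.last j) → r ≠ t → tropWeight d v τs r < tropWeight d v τs (q (Fin.last j))) :
    (∀ k, IsDominant d v ε ((Fin.snoc ψ s : Fin (j + 2) → ℤ) k) ((Fin.snoc q t : Fin (j + 2) → _) k)) ∧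
    (∀ k : Fin (j + 1), (Fin.snoc ψ s : Fin (j + 2) → ℤ) k.castSucc < (Fin.snoc τ τs : Fin (j + 1) → ℤ) k ∧
      (Fin.snoc τ τs : Fin (j + 1) → ℤ) k < (Fin.snoc ψ s : Fin (j + 2) → ℤ) k.succ) ∧
    (∀ k : Fin (j + 1), (Fin.snoc q t : Fin (j + 2) → _) k.castSucc ≠ (Fin.snoc q t : Fin (j + 2) → _) k.succ) ∧
    (∀ k : Fin (j + 1), tropWeight d v ((Fin.snoc τ τs : Fin (j + 1) → ℤ) k) ((Fin.snoc q t : Fin (j + 2) → _) k.castSucc) =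
      tropWeight d v ((Fin.snoc τ τs : Fin (j + 1) → ℤ) k) ((Fin.snoc q t : Fin (j + 2) → _) k.succ)) ∧
    (∀ k : Fin (j + 1), ∀ r, termSign ε r ≠ 0 → r ≠ (Fin.snoc q t : Fin (j + 2) → _) k.castSucc →
      r ≠ (Fin.snoc q t : Fin (j + 2) → _) k.succ →
      tropWeight d v ((Fin.snoc τ τs : Fin (j + 1) → ℤ) k) r <
        tropWeight d v ((Fin.snoc τ τs : Fin (j + 1) → ℤ) k) ((Fin.snoc q t : Fin (j + 2) → _) k.castSucc)) ∧
    (Fin.snoc q t : Fin (j + 2) → _) 0 = q 0 ∧ (Fin.snoc ψ s : Fin (j + 2) → ℤ) 0 = ψ 0 ∧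
    (Fin.snoc q t : Fin (j + 2) → _) (Fin.last (j + 1)) = t ∧ (Fin.snoc ψ s : Fin (j + 2) → ℤ) (Fin.last (j + 1)) = s := by
  refine ⟨fun k => ?_, fun k => ?_, fun k => ?_, fun k => ?_, fun k => ?_, ?_, ?_, Fin.snoc_last _ _, Fin.snoc_last _ _⟩
  · refine Fin.lastCases ?_ (fun i => ?_) k
    · simp only [Fin.snoc_last]; exact ht
    · simp only [Fin.snoc_castSucc]; exact hdom i
  · refine Fin.lastCases ?_ (fun i => ?_) k
    · simp only [Fin.snoc_castSucc, Fin.snoc_last, Fin.succ_last]; exact hsep'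
    · simp only [Fin.succ_castSucc, Fin.snoc_castSucc]; exact hsep i
  · refine Fin.lastCases ?_ (fun i => ?_) k
    · simp only [Fin.snoc_castSucc, Fin.snoc_last, Fin.succ_last]; exact hne'
    · simp only [Fin.succ_castSucc, Fin.snoc_castSucc]; exact hne i
  · refine Fin.lastCases ?_ (fun i => ?_) k
    · simp only [Fin.snoc_castSucc, Fin.snoc_last, Fin.succ_last]; exact htie'
    · simp only [Fin.succ_castSucc, Fin.snoc_castSucc]; exact htie i
  · refine Fin.lastCases ?_ (fun i => ?_) k
    · simp only [Fin.snoc_castSucc, Fin.snoc_last, Fin.succ_last]; exact honly'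
    · simp only [Fin.succ_castSucc, Fin.snoc_castSucc]; exact honly i
  · rw [← Fin.castSucc_zero, Fin.snoc_castSucc]
  · rw [← Fin.castSucc_zero, Fin.snoc_castSucc]

/-- **Tight extension.**  In a 4-generic design a tight chain `(q, ψ, τ)` with `j + 1` terms whose last term `q_j` is dominant at `ψ_j` extends,
for every `p' ≠ q_j` dominant at `θ' > ψ_j`, to a tight chain with `j' + 1 ≥ j + 2` terms, the same first term and first slope, last term `p'`
and last slope `θ'`.  (Induction on `sl p' − sl q_j` along `exists_step`.) [folklore] -/
theorem exists_extension
    (hG1 : ∀ q q' : Equiv.Perm (Fin m) × (Fin m → Fin K), termSign ε q ≠ 0 → termSign ε q' ≠ 0 → q ≠ q' →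
      (∑ i, (d (q.2 i) : ℤ)) = ∑ i, (d (q'.2 i) : ℤ) → (∑ i, v (q.1 i) i (q.2 i)) ≠ ∑ i, v (q'.1 i) i (q'.2 i))
    (hG2 : ∀ q₁ q₂ q₃ : Equiv.Perm (Fin m) × (Fin m → Fin K), termSign ε q₁ ≠ 0 → termSign ε q₂ ≠ 0 → termSign ε q₃ ≠ 0 →
      (∑ i, (d (q₁.2 i) : ℤ)) < ∑ i, (d (q₂.2 i) : ℤ) → (∑ i, (d (q₂.2 i) : ℤ)) < ∑ i, (d (q₃.2 i) : ℤ) →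
      ((∑ i, (d (q₂.2 i) : ℤ)) - ∑ i, (d (q₁.2 i) : ℤ)) * ((∑ i, v (q₃.1 i) i (q₃.2 i)) - ∑ i, v (q₁.1 i) i (q₁.2 i)) ≠
        ((∑ i, (d (q₃.2 i) : ℤ)) - ∑ i, (d (q₁.2 i) : ℤ)) * ((∑ i, v (q₂.1 i) i (q₂.2 i)) - ∑ i, v (q₁.1 i) i (q₁.2 i)))
    (hG3 : ∀ q q' : Equiv.Perm (Fin m) × (Fin m → Fin K), termSign ε q ≠ 0 → termSign ε q' ≠ 0 →
      (∑ i, (d (q.2 i) : ℤ)) < ∑ i, (d (q'.2 i) : ℤ) →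
      ∃ ψ : ℤ, (∑ i, v (q'.1 i) i (q'.2 i)) - (∑ i, v (q.1 i) i (q.2 i)) = ψ * ((∑ i, (d (q'.2 i) : ℤ)) - ∑ i, (d (q.2 i) : ℤ)) ∧ 4 ∣ ψ)
    (N : ℕ) :
    ∀ (j : ℕ) (q : Fin (j + 1) → Equiv.Perm (Fin m) × (Fin m → Fin K)) (ψ : Fin (j + 1) → ℤ) (τ : Fin j → ℤ),
    (∀ k, IsDominant d v ε (ψ k) (q k)) →
    (∀ k : Fin j, ψ k.castSucc < τ k ∧ τ k < ψ k.succ) →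
    (∀ k : Fin j, q k.castSucc ≠ q k.succ) →
    (∀ k : Fin j, tropWeight d v (τ k) (q k.castSucc) = tropWeight d v (τ k) (q k.succ)) →
    (∀ k : Fin j, ∀ r, termSign ε r ≠ 0 → r ≠ q k.castSucc → r ≠ q k.succ →
      tropWeight d v (τ k) r < tropWeight d v (τ k) (q k.castSucc)) →
    ∀ (θ' : ℤ) (p' : Equiv.Perm (Fin m) × (Fin m → Fin K)), IsDominant d v ε θ' p' → ψ (Fin.last j) < θ' → q (Fin.last j) ≠ p' →
    ((∑ i, (d (p'.2 i) : ℤ)) - ∑ i, (d ((q (Fin.last j)).2 i) : ℤ)).toNat ≤ N →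
    ∃ (j' : ℕ) (q' : Fin (j' + 1) → Equiv.Perm (Fin m) × (Fin m → Fin K)) (ψ' : Fin (j' + 1) → ℤ) (τ' : Fin j' → ℤ),
      j + 1 ≤ j' ∧
      (∀ k, IsDominant d v ε (ψ' k) (q' k)) ∧
      (∀ k : Fin j', ψ' k.castSucc < τ' k ∧ τ' k < ψ' k.succ) ∧
      (∀ k : Fin j', q' k.castSucc ≠ q' k.succ) ∧
      (∀ k : Fin j', tropWeight d v (τ' k) (q' k.castSucc) = tropWeight d v (τ' k) (q' k.succ)) ∧
      (∀ k : Fin j', ∀ r, termSign ε r ≠ 0 → r ≠ q' k.castSucc → r ≠ q' k.succ →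
        tropWeight d v (τ' k) r < tropWeight d v (τ' k) (q' k.castSucc)) ∧
      q' 0 = q 0 ∧ ψ' 0 = ψ 0 ∧ q' (Fin.last j') = p' ∧ ψ' (Fin.last j') = θ' := by
  induction N with
  | zero =>
    intro j q ψ τ hdom hsep hne htie honly θ' p' hp' hlt hqp' hN
    exfalso
    obtain ⟨t, τs, _, _, _, _, _, _, _, _, hsl1, hsl2⟩ := exists_step d v ε hG1 hG2 hG3 (hdom (Fin.last j)) hp' hlt hqp'
    have : (0 : ℤ) < (∑ i, (d (p'.2 i) : ℤ)) - ∑ i, (d ((q (Fin.last j)).2 i) : ℤ) := by linarith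
    omega
  | succ N ih =>
    intro j q ψ τ hdom hsep hne htie honly θ' p' hp' hlt hqp' hN
    obtain ⟨t, τs, ht_pres, htq, hψτ, hτθ', hdich, htie', honly', htdom, hsl1, hsl2⟩ :=
      exists_step d v ε hG1 hG2 hG3 (hdom (Fin.last j)) hp' hlt hqp'
    by_cases htp' : t = p'
    · -- finish: append `p'` at slope `θ'` with tie slope `τs`
      subst htp'
      obtain ⟨h1, h2, h3, h4, h5, h6, h7, h8, h9⟩ := snoc_tight d v ε q ψ τ hdom hsep hne htie honly t θ' τs hp' ⟨hψτ, hτθ'⟩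
        (Ne.symm htq) htie' honly'
      exact ⟨j + 1, Fin.snoc q t, Fin.snoc ψ θ', Fin.snoc τ τs, le_rfl, h1, h2, h3, h4, h5, h6, h7, h8, h9⟩
    · -- continue from the catcher `t`, dominant at `τs + 1 < θ'`
      have hlt' : τs + 1 < θ' := hdich.resolve_right htp'
      obtain ⟨h1, h2, h3, h4, h5, h6, h7, h8, h9⟩ := snoc_tight d v ε q ψ τ hdom hsep hne htie honly t (τs + 1) τs htdom
        ⟨hψτ, by omega⟩ (Ne.symm htq) htie' honly'
      have hN' : ((∑ i, (d (p'.2 i) : ℤ)) - ∑ i, (d (((Fin.snoc q t : Fin (j + 2) → _) (Fin.last (j + 1))).2 i) : ℤ)).toNat ≤ N := by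
        rw [h8]; omega
      obtain ⟨j', q', ψ', τ', hj', g1, g2, g3, g4, g5, g6, g7, g8, g9⟩ :=
        ih (j + 1) (Fin.snoc q t) (Fin.snoc ψ (τs + 1)) (Fin.snoc τ τs) h1 h2 h3 h4 h5 θ' p' hp' (by rw [h9]; exact hlt')
          (by rw [h8]; exact htp') hN'
      exact ⟨j', q', ψ', τ', by omega, g1, g2, g3, g4, g5, by rw [g6, h6], by rw [g7, h7], g8, g9⟩

/-- **Tight refinement of an unsigned chain.**  In a 4-generic design every chain `p₀, …, pₙ` of terms dominant at strictly increasing integer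
slopes `θ₀ < ⋯ < θₙ` with consecutive terms distinct is refined to a TIGHT chain `q₀, …, q_j`, `j ≥ n`, with `q₀ = p₀` at `θ₀` and `q_j = pₙ` at
`θₙ`: consecutive terms distinct and tying TWO-TERM at an integer slope strictly between their exposing slopes. [folklore] -/
theorem exists_refinement
    (hG1 : ∀ q q' : Equiv.Perm (Fin m) × (Fin m → Fin K), termSign ε q ≠ 0 → termSign ε q' ≠ 0 → q ≠ q' →
      (∑ i, (d (q.2 i) : ℤ)) = ∑ i, (d (q'.2 i) : ℤ) → (∑ i, v (q.1 i) i (q.2 i)) ≠ ∑ i, v (q'.1 i) i (q'.2 i))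
    (hG2 : ∀ q₁ q₂ q₃ : Equiv.Perm (Fin m) × (Fin m → Fin K), termSign ε q₁ ≠ 0 → termSign ε q₂ ≠ 0 → termSign ε q₃ ≠ 0 →
      (∑ i, (d (q₁.2 i) : ℤ)) < ∑ i, (d (q₂.2 i) : ℤ) → (∑ i, (d (q₂.2 i) : ℤ)) < ∑ i, (d (q₃.2 i) : ℤ) →
      ((∑ i, (d (q₂.2 i) : ℤ)) - ∑ i, (d (q₁.2 i) : ℤ)) * ((∑ i, v (q₃.1 i) i (q₃.2 i)) - ∑ i, v (q₁.1 i) i (q₁.2 i)) ≠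
        ((∑ i, (d (q₃.2 i) : ℤ)) - ∑ i, (d (q₁.2 i) : ℤ)) * ((∑ i, v (q₂.1 i) i (q₂.2 i)) - ∑ i, v (q₁.1 i) i (q₁.2 i)))
    (hG3 : ∀ q q' : Equiv.Perm (Fin m) × (Fin m → Fin K), termSign ε q ≠ 0 → termSign ε q' ≠ 0 →
      (∑ i, (d (q.2 i) : ℤ)) < ∑ i, (d (q'.2 i) : ℤ) →
      ∃ ψ : ℤ, (∑ i, v (q'.1 i) i (q'.2 i)) - (∑ i, v (q.1 i) i (q.2 i)) = ψ * ((∑ i, (d (q'.2 i) : ℤ)) - ∑ i, (d (q.2 i) : ℤ)) ∧ 4 ∣ ψ)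
    {n : ℕ} (θ : Fin (n + 1) → ℤ) (p : Fin (n + 1) → Equiv.Perm (Fin m) × (Fin m → Fin K))
    (hθ : StrictMono θ) (hdom : ∀ k, IsDominant d v ε (θ k) (p k)) (hne : ∀ k : Fin n, p k.castSucc ≠ p k.succ) :
    ∃ (j : ℕ) (q : Fin (j + 1) → Equiv.Perm (Fin m) × (Fin m → Fin K)) (ψ : Fin (j + 1) → ℤ) (τ : Fin j → ℤ),
      n ≤ j ∧
      (∀ k, IsDominant d v ε (ψ k) (q k)) ∧
      (∀ k : Fin j, ψ k.castSucc < τ k ∧ τ k < ψ k.succ) ∧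
      (∀ k : Fin j, q k.castSucc ≠ q k.succ) ∧
      (∀ k : Fin j, tropWeight d v (τ k) (q k.castSucc) = tropWeight d v (τ k) (q k.succ)) ∧
      (∀ k : Fin j, ∀ r, termSign ε r ≠ 0 → r ≠ q k.castSucc → r ≠ q k.succ →
        tropWeight d v (τ k) r < tropWeight d v (τ k) (q k.castSucc)) ∧
      q 0 = p 0 ∧ ψ 0 = θ 0 ∧ q (Fin.last j) = p (Fin.last n) ∧ ψ (Fin.last j) = θ (Fin.last n) := by
  -- by induction along the chain: a tight chain from `p₀` to `p_k` at `θ_k`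
  suffices h : ∀ k : Fin (n + 1), ∃ (j : ℕ) (q : Fin (j + 1) → Equiv.Perm (Fin m) × (Fin m → Fin K)) (ψ : Fin (j + 1) → ℤ)
      (τ : Fin j → ℤ), (k : ℕ) ≤ j ∧
      (∀ k, IsDominant d v ε (ψ k) (q k)) ∧
      (∀ k : Fin j, ψ k.castSucc < τ k ∧ τ k < ψ k.succ) ∧
      (∀ k : Fin j, q k.castSucc ≠ q k.succ) ∧
      (∀ k : Fin j, tropWeight d v (τ k) (q k.castSucc) = tropWeight d v (τ k) (q k.succ)) ∧
      (∀ k : Fin j, ∀ r, termSign ε r ≠ 0 → r ≠ q k.castSucc → r ≠ q k.succ →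
        tropWeight d v (τ k) r < tropWeight d v (τ k) (q k.castSucc)) ∧
      q 0 = p 0 ∧ ψ 0 = θ 0 ∧ q (Fin.last j) = p k ∧ ψ (Fin.last j) = θ k by
    simpa using h (Fin.last n)
  intro k
  induction k using Fin.induction with
  | zero =>
    exact ⟨0, fun _ => p 0, fun _ => θ 0, Fin.elim0, le_rfl, fun _ => hdom 0, fun k => k.elim0, fun k => k.elim0, fun k => k.elim0,
      fun k => k.elim0, rfl, rfl, rfl, rfl⟩
  | succ k ih =>
    obtain ⟨j, q, ψ, τ, hj, h1, h2, h3, h4, h5, h6, h7, h8, h9⟩ := ih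
    have hlt : ψ (Fin.last j) < θ k.succ := by rw [h9]; exact hθ Fin.castSucc_lt_succ
    have hne' : q (Fin.last j) ≠ p k.succ := by rw [h8]; exact hne k
    obtain ⟨j', q', ψ', τ', hj', g1, g2, g3, g4, g5, g6, g7, g8, g9⟩ :=
      exists_extension d v ε hG1 hG2 hG3 _ j q ψ τ h1 h2 h3 h4 h5 (θ k.succ) (p k.succ) (hdom k.succ) hlt hne' le_rfl
    refine ⟨j', q', ψ', τ', ?_, g1, g2, g3, g4, g5, by rw [g6, h6], by rw [g7, h7], g8, g9⟩
    have hk : ((k.castSucc : Fin (n + 1)) : ℕ) = (k : ℕ) := Fin.val_castSucc k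
    simp only [Fin.val_succ]; omega

end Generic

end TightChain

end Summit.ValiantsHypothesis.ValiantsHypothesis.Theorems.KPlusLogSqLaw
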